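import Summits.QuantumFields.BalabanUV.Beta.FP.FarRegionSmear

/-!
# `BalabanUV.Beta.FP.FarRegionBubble` — road «FP» (binder row D1), `RHOA-DESIGN.md` §3 (F-PC) ∕ §5 row RHOA-4 «FAR-REGION MOMENT» (b) «bubble-level», FILE D:
# THE BRACKET DOUBLE SMEAR AT A FAR POINT — two exponentially localised two-point vertex weights read two legs, each through a FIRST DIFFERENCE over a
# unit-scale displacement (the form a PARTIAL zero moment of each vertex produces); the truncated order-zero engine per leg gives
# `|Σ' V(x,w)W(y,u)(F(z+u−x) − F(z+u−w))(G(z+y−w) − G(z+u−w))| ≤ CV·CW·(16αFαG·θ₂θ₀ + e^{−(δ/2)R}(8(αFGg + αGFg)θ₁θ₀ + 4FgGgθ₀²))` with OUTER leg data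
# ([folklore] lattice bookkeeping on `ℤ⁴`; G-an2-4 formalisation swarm, unit `b2b-balaban-gan24-formalise-leaf-06`, gen 32, cross-lane idle-seat brick)

HONEST DEPENDENCY (page 1, mandatory): continuum YM on T⁴ ⇐ BetaPertH ∧ nine spine estimates (0/9 proved); BetaPertH ⇐ (D1) ∧ (D4) ∧
CAP+tail; G-an2-4 gates asym, D1 and NE2/3/4.  HONEST FRAMING (cell contract, verbatim): «discharging `BetaPertH` makes Bałaban's UV
stability UNCONDITIONAL — a real constructive-QFT result; it is NOT the continuum limit and NOT the Clay problem.»  THIS MODULE is elementary [folklore]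
real analysis on `ℤ⁴` over leaf-02-g6's H2-a engine (`ExpLocalisedBubble.abs_sub_le_near_far_pow`, `tsum_prod_expWeight_pow_le`, `nonneg_of_loc`) and gen-32's
`FP/FarRegionSmear` (outer truncation: `abs_outer_le`, `inner_vanish`, `outer_of_mem_box`) BY NAME; it asserts nothing about Bałaban's objects, cites nothing, mints no
`Prop` fact, has no `def`, 0 sorry.  The legs' OUTER data (`aF`, `bF`: sup and first differences beyond `‖z‖∞/2` ∕ on the box), the global bounds and the weights'
localisation are HYPOTHESES; that the one-loop bubble of the H′ route HAS this bracket form (partial zero moments of the cubic vertices) and the graded data of its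
legs are the suppliers' rows (H2V, IR-5∕IR-6), NOT here.  NOT `hbook`, NOT `ρ_n = O(1)`, NOT D1, NOT BetaPertH, NOT continuum, NOT Clay; «not in print; our bookkeeping».

WHY (RHOA-DESIGN §5 RHOA-4 (b) «bubble-level: graded legs … + exp-local zero-moment vertices ⟹ shape (a)»).  With `Σ_x V(x,w) = 0` and `Σ_y W(y,u) = 0` the bubble
`Σ V(x,w)W(y,u)F(z+u−x)G(z+y−w)` equals the BRACKET form below (each leg minus its value at the partner's point); ONE difference per leg costs `‖z‖⁻¹` each against
degree-2 legs, hence `‖z‖⁻⁶` — no second differences needed.  At a far point `‖z‖∞ ≥ 8` each leg is split into its OUTER truncation (read by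
`ExpLocalisedBubble.abs_sub_le_near_far_pow` with `k = 1` and the OUTER sup) and the inner complement (seen only through displacements `|s|₁ > (‖z‖∞−1)/2`, paid by the
weights as `e^{−(δ/2)R}`).
CONTENT (`ρ := ⌊‖z‖∞/4⌋`, `R := (‖z‖∞−1)/2`, `θ_m := 2^{m+1}(m!e^{δ/4}(4/δ)^m)e^{δ/4}Zl 4 (δ/4)²` = the engine's letters at rate `δ/2`).
* §1 **`abs_leg_sub_le_far`**: `|F(z+s₁) − F(z+s₂)| ≤ (4b + 2a₀/ρ)(|s₁|₁+|s₂|₁) + Fg(𝟙[|s₁|₁>R] + 𝟙[|s₂|₁>R])` (global `|F| ≤ Fg`, OUTER sup `a₀`, box first differences `b`).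
* §2 `shifts_le`, `exp_mul_indicator_le` (`e^{−δL}𝟙[l>R] ≤ e^{−(δ/2)R}e^{−(δ/2)L}` for `l ≤ L`), `pointwise_dom` (one term against the product letters `ω_m(x,w)ω_k(y,u)`),
  **`abs_bracket_le_far`**: summability of the bracket family over `(ℤ⁴×ℤ⁴)×(ℤ⁴×ℤ⁴)` and the displayed bound with `αF := 4bF + 2aF/ρ`, `αG := 4bG + 2aG/ρ`.
The graded corollary (scale-`n` graded legs ⟹ the far shape of `FP/FarRegionMoment` with `(a, b) = (6, 2)` for degree-2 legs) is the sequel `FP/FarRegionBubbleGraded`.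
Provenance: leaf prover 06 (gen 32), 2026-08-21; no existing file touched.
-/

noncomputable section

namespace Summit.QuantumFields.BalabanUV.Beta.FP.FarRegionBubble

open Finset Filter Topology fwdDiff
open scoped BigOperators
open Literature.MathematicalPhysics.QuantumFieldTheory.Balaban1983to89
open Literature.MathematicalPhysics.QuantumFieldTheory.Balaban1983to89.Beta
open B12Sec2to5 (l1 l1_nonneg abs_coord_le_l1)
open ExpKernelCalculus (Site Zl Zl_pos l1_sub_triangle l1_sub_symm)
open DyadicShell (Pt supNorm)
open Summit.QuantumFields.BalabanUV.Beta.FP.HorizontalBookkeepingTail (supNorm_le_add_of_box)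
open Summit.QuantumFields.BalabanUV.Beta.FP.ExpLocalisedBubble
open Summit.QuantumFields.BalabanUV.Beta.FP.FarRegionSmear

/-! ## §1 One leg, two shifted arguments, at a far point: the truncated order-zero engine -/

section Leg

variable {F : Pt → ℝ} {Fg a₀ b : ℝ} {z : Pt}

/-- [folklore] **ONE LEG AT TWO SHIFTED ARGUMENTS, FAR POINT** (`‖z‖∞ ≥ 8`, `ρ := ⌊‖z‖∞/4⌋`, `R := (‖z‖∞−1)/2`): with the global bound `|F| ≤ Fg`, the OUTER
sup `a₀` (`‖z‖∞ ≤ 2‖t‖∞`) and first differences `≤ b` on the box of radius `ρ` around `z`,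
`|F(z+s₁) − F(z+s₂)| ≤ (4b + 2a₀/ρ)·(|s₁|₁ + |s₂|₁) + Fg·(𝟙[|s₁|₁ > R] + 𝟙[|s₂|₁ > R])`
(`ExpLocalisedBubble.abs_sub_le_near_far_pow` with `k = 1` on the outer truncation, twice, + the inner complement). -/
theorem abs_leg_sub_le_far (hg : ∀ t, |F t| ≤ Fg) (hz : 8 ≤ supNorm z) (hb : 0 ≤ b)
    (hout0 : ∀ t : Pt, supNorm z ≤ 2 * supNorm t → |F t| ≤ a₀)
    (hout1 : ∀ t : Pt, (∀ i, |t i - z i| ≤ ((supNorm z / 4 : ℕ) : ℤ)) → ∀ i, |F (t + Pi.single i 1) - F t| ≤ b)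
    (s₁ s₂ : Pt) :
    |F (z + s₁) - F (z + s₂)|
      ≤ (4 * b + 2 * a₀ / (((supNorm z / 4 : ℕ) : ℕ) : ℝ)) * (l1 s₁ + l1 s₂)
        + Fg * ((if l1 s₁ ≤ ((supNorm z : ℝ) - 1) / 2 then 0 else 1) + (if l1 s₂ ≤ ((supNorm z : ℝ) - 1) / 2 then 0 else 1)) := by
  set Fo : Pt → ℝ := fun t => if supNorm z ≤ 2 * supNorm t then F t else 0 with hFo
  have hA : ∀ t, |Fo t| ≤ a₀ := abs_outer_le hout0
  have hρ : 0 < supNorm z / 4 := by omega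
  have hρ' : (0 : ℝ) < (((supNorm z / 4 : ℕ) : ℕ) : ℝ) := by exact_mod_cast hρ
  have hF1 : ∀ t : Pt, (∀ i, |t i - z i| ≤ ((supNorm z / 4 : ℕ) : ℤ)) → ∀ i, |Fo (t + Pi.single i 1) - Fo t| ≤ b := by
    intro t ht i
    obtain ⟨h0, h1, -⟩ := outer_of_mem_box hz ht
    simp only [hFo, if_pos h0, if_pos (h1 i)]
    exact hout1 t ht i
  have hnear := fun s => abs_sub_le_near_far_pow (D := 4) (F := Fo) (y := z) hρ hb 1 hA hF1 s
  -- the inner complement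
  have hin : ∀ s : Pt, |F (z + s) - Fo (z + s)| ≤ Fg * (if l1 s ≤ ((supNorm z : ℝ) - 1) / 2 then 0 else 1) := by
    intro s
    by_cases hs : l1 s ≤ ((supNorm z : ℝ) - 1) / 2
    · rw [if_pos hs, mul_zero]
      have := inner_vanish (H := F) (z := z) s hs
      rw [this, abs_zero]
    · rw [if_neg hs, mul_one]
      by_cases h : supNorm z ≤ 2 * supNorm (z + s)
      · simp only [hFo, if_pos h, sub_self, abs_zero]; exact (abs_nonneg _).trans (hg z)
      · simp only [hFo, if_neg h, sub_zero]; exact hg _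
  have e : F (z + s₁) - F (z + s₂)
      = (Fo (z + s₁) - Fo z) - (Fo (z + s₂) - Fo z) + ((F (z + s₁) - Fo (z + s₁)) - (F (z + s₂) - Fo (z + s₂))) := by ring
  rw [e]
  have h1 := hnear s₁
  have h2 := hnear s₂
  have h3 := hin s₁
  have h4 := hin s₂
  simp only [pow_one] at h1 h2
  calc |(Fo (z + s₁) - Fo z) - (Fo (z + s₂) - Fo z) + ((F (z + s₁) - Fo (z + s₁)) - (F (z + s₂) - Fo (z + s₂)))|
      ≤ (|Fo (z + s₁) - Fo z| + |Fo (z + s₂) - Fo z|) + (|F (z + s₁) - Fo (z + s₁)| + |F (z + s₂) - Fo (z + s₂)|) :=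
        (abs_add_le _ _).trans (add_le_add (abs_sub _ _) (abs_sub _ _))
    _ ≤ (((4 : ℕ) : ℝ) * b * l1 s₁ + 2 * a₀ * (l1 s₁ / (((supNorm z / 4 : ℕ) : ℕ) : ℝ))
          + (((4 : ℕ) : ℝ) * b * l1 s₂ + 2 * a₀ * (l1 s₂ / (((supNorm z / 4 : ℕ) : ℕ) : ℝ))))
        + (Fg * (if l1 s₁ ≤ ((supNorm z : ℝ) - 1) / 2 then 0 else 1) + Fg * (if l1 s₂ ≤ ((supNorm z : ℝ) - 1) / 2 then 0 else 1)) :=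
        add_le_add (add_le_add h1 h2) (add_le_add h3 h4)
    _ = _ := by push_cast; field_simp

end Leg

/-! ## §2 The bracket double smear against two exponentially localised two-point weights: the far bound with OUTER leg data -/

section Bubble

variable {V W : Pt × Pt → ℝ} {F G : Pt → ℝ} {CV CW δ Fg Gg aF aG bF bG : ℝ} {z : Pt}

/-- [folklore] The sum `|x|₁+|w|₁+|y|₁+|u|₁` controls every shift of the bracket form and its indicator. -/
theorem shifts_le (x w y u : Pt) :
    l1 (u - x) ≤ l1 x + l1 w + l1 y + l1 u ∧ l1 (u - w) ≤ l1 x + l1 w + l1 y + l1 u ∧ l1 (y - w) ≤ l1 x + l1 w + l1 y + l1 u := by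
  have hx := l1_nonneg x; have hw := l1_nonneg w; have hy := l1_nonneg y; have hu := l1_nonneg u
  have tri : ∀ a b : Pt, l1 (a - b) ≤ l1 a + l1 b := fun a b => by
    have t := l1_sub_triangle a 0 b
    rwa [sub_zero, l1_sub_symm 0 b, sub_zero] at t
  refine ⟨?_, ?_, ?_⟩
  · have := tri u x; linarith
  · have := tri u w; linarith
  · have := tri y w; linarith

/-- [folklore] An indicator `𝟙[|s|₁ > R]` with `|s|₁ ≤ L` is dominated by `𝟙[L > R]`, and on `{L > R}` the weight `e^{−δL}` pays `e^{−(δ/2)R}`: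
`e^{−δL}·𝟙[|s|₁ > R] ≤ e^{−(δ/2)R}·e^{−(δ/2)L}` (`δ ≥ 0`). -/
theorem exp_mul_indicator_le {δ L R l : ℝ} (hδ : 0 ≤ δ) (hl : l ≤ L) :
    Real.exp (-δ * L) * (if l ≤ R then (0 : ℝ) else 1) ≤ Real.exp (-(δ / 2) * R) * Real.exp (-(δ / 2) * L) := by
  by_cases h : l ≤ R
  · rw [if_pos h, mul_zero]; positivity
  · rw [if_neg h, mul_one, ← Real.exp_add]
    push Not at h
    exact Real.exp_le_exp.mpr (by nlinarith)

/-- [folklore] THE POINTWISE MAJORANT of one term of the bracket double smear by the product letters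
`ω_m(x,w)·ω_k(y,u)`, `ω_m(p) := e^{−(δ/2)|p.1|₁}e^{−(δ/2)|p.2|₁}((|p.1|₁+1)+(|p.2|₁+1))^m` (passed as `ω` with its defining equation `hω`):
main term `8αFαG·(ω₂ω₀ + ω₀ω₂)`, mixed `e^{−(δ/2)R}·4(αF·Gg + αG·Fg)·(ω₁ω₀ + ω₀ω₁)`, indicator `e^{−(δ/2)R}·4FgGg·ω₀ω₀`, all times `CV·CW`. -/
theorem pointwise_dom {x w' y u : Pt} {vV vW bF' bG' : ℝ} {CV CW δ αF αG Fg Gg R : ℝ} {ω : ℕ → Pt × Pt → ℝ}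
    (hω : ∀ m p, ω m p = Real.exp (-(δ / 2) * l1 p.1) * Real.exp (-(δ / 2) * l1 p.2) * ((l1 p.1 + 1) + (l1 p.2 + 1)) ^ m)
    (hδ : 0 ≤ δ) (hCV : 0 ≤ CV) (hCW : 0 ≤ CW) (hαF : 0 ≤ αF) (hαG : 0 ≤ αG) (hFg : 0 ≤ Fg) (hGg : 0 ≤ Gg)
    (hv : |vV| ≤ CV * (Real.exp (-δ * l1 x) * Real.exp (-δ * l1 w'))) (hvw : |vW| ≤ CW * (Real.exp (-δ * l1 y) * Real.exp (-δ * l1 u)))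
    (hBF : |bF'| ≤ αF * (l1 (u - x) + l1 (u - w'))
      + Fg * ((if l1 (u - x) ≤ R then (0 : ℝ) else 1) + (if l1 (u - w') ≤ R then (0 : ℝ) else 1)))
    (hBG : |bG'| ≤ αG * (l1 (y - w') + l1 (u - w'))
      + Gg * ((if l1 (y - w') ≤ R then (0 : ℝ) else 1) + (if l1 (u - w') ≤ R then (0 : ℝ) else 1))) :
    ‖vV * vW * (bF' * bG')‖
      ≤ CV * CW * (8 * αF * αG) * (ω 2 (x, w') * ω 0 (y, u) + ω 0 (x, w') * ω 2 (y, u))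
        + CV * CW * Real.exp (-(δ / 2) * R) * (4 * (αF * Gg + αG * Fg)) * (ω 1 (x, w') * ω 0 (y, u) + ω 0 (x, w') * ω 1 (y, u))
        + CV * CW * Real.exp (-(δ / 2) * R) * (4 * Fg * Gg) * (ω 0 (x, w') * ω 0 (y, u)) := by
  have hx := l1_nonneg x; have hw' := l1_nonneg w'; have hy := l1_nonneg y; have hu := l1_nonneg u
  obtain ⟨hs1, hs2, hs3⟩ := shifts_le x w' y u
  -- the total letter `L` and its indicator
  obtain ⟨L, hL⟩ : ∃ L : ℝ, L = l1 x + l1 w' + l1 y + l1 u := ⟨_, rfl⟩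
  have hL0 : 0 ≤ L := by rw [hL]; positivity
  rw [← hL] at hs1 hs2 hs3
  obtain ⟨χL, hχL⟩ : ∃ c : ℝ, c = if L ≤ R then 0 else 1 := ⟨_, rfl⟩
  have hχL0 : 0 ≤ χL := by rw [hχL]; split_ifs <;> norm_num
  have hχL1 : χL ≤ 1 := by rw [hχL]; split_ifs <;> norm_num
  have hχle : ∀ s : Pt, l1 s ≤ L → (if l1 s ≤ R then (0 : ℝ) else 1) ≤ χL := fun s hs => by
    rw [hχL]
    by_cases h : L ≤ R
    · rw [if_pos (hs.trans h), if_pos h]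
    · rw [if_neg h]; split_ifs <;> norm_num
  -- |bracket_F| ≤ 2 αF L + 2 Fg χL, |bracket_G| ≤ 2 αG L + 2 Gg χL
  have hBF' : |bF'| ≤ 2 * αF * L + 2 * Fg * χL := by
    have h1 : αF * (l1 (u - x) + l1 (u - w')) ≤ αF * (2 * L) := mul_le_mul_of_nonneg_left (by linarith) hαF
    have h2 : Fg * ((if l1 (u - x) ≤ R then (0 : ℝ) else 1) + (if l1 (u - w') ≤ R then (0 : ℝ) else 1)) ≤ Fg * (2 * χL) :=
      mul_le_mul_of_nonneg_left (by linarith [hχle _ hs1, hχle _ hs2]) hFg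
    linarith
  have hBG' : |bG'| ≤ 2 * αG * L + 2 * Gg * χL := by
    have h1 : αG * (l1 (y - w') + l1 (u - w')) ≤ αG * (2 * L) := mul_le_mul_of_nonneg_left (by linarith) hαG
    have h2 : Gg * ((if l1 (y - w') ≤ R then (0 : ℝ) else 1) + (if l1 (u - w') ≤ R then (0 : ℝ) else 1)) ≤ Gg * (2 * χL) :=
      mul_le_mul_of_nonneg_left (by linarith [hχle _ hs3, hχle _ hs2]) hGg
    linarith
  -- the weights
  have hE : Real.exp (-δ * l1 x) * Real.exp (-δ * l1 w') * (Real.exp (-δ * l1 y) * Real.exp (-δ * l1 u)) = Real.exp (-δ * L) := by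
    rw [← Real.exp_add, ← Real.exp_add, ← Real.exp_add, hL]; congr 1; ring
  have hVW : |vV| * |vW| ≤ CV * CW * Real.exp (-δ * L) := by
    calc |vV| * |vW| ≤ (CV * (Real.exp (-δ * l1 x) * Real.exp (-δ * l1 w'))) * (CW * (Real.exp (-δ * l1 y) * Real.exp (-δ * l1 u))) :=
          mul_le_mul hv hvw (abs_nonneg _) (by positivity)
      _ = CV * CW * Real.exp (-δ * L) := by rw [← hE]; ring
  -- the pair letters
  obtain ⟨Lp, hLp⟩ : ∃ c : ℝ, c = (l1 x + 1) + (l1 w' + 1) := ⟨_, rfl⟩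
  obtain ⟨Lq, hLq⟩ : ∃ c : ℝ, c = (l1 y + 1) + (l1 u + 1) := ⟨_, rfl⟩
  have hLle : L ≤ Lp + Lq := by rw [hL, hLp, hLq]; linarith
  have hLp0 : 0 ≤ Lp := by rw [hLp]; positivity
  have hLq0 : 0 ≤ Lq := by rw [hLq]; positivity
  have hL2 : L ^ 2 ≤ 2 * (Lp ^ 2 + Lq ^ 2) := by
    have h1 : L ^ 2 ≤ (Lp + Lq) ^ 2 := pow_le_pow_left₀ hL0 hLle 2
    have h2 : 2 * (Lp ^ 2 + Lq ^ 2) - (Lp + Lq) ^ 2 = (Lp - Lq) ^ 2 := by ring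
    linarith [sq_nonneg (Lp - Lq)]
  have hEL : Real.exp (-(δ / 2) * l1 x) * Real.exp (-(δ / 2) * l1 w') * (Real.exp (-(δ / 2) * l1 y) * Real.exp (-(δ / 2) * l1 u))
      = Real.exp (-(δ / 2) * L) := by
    rw [← Real.exp_add, ← Real.exp_add, ← Real.exp_add, hL]; congr 1; ring
  have ew : ∀ m k : ℕ, ω m (x, w') * ω k (y, u) = Real.exp (-(δ / 2) * L) * (Lp ^ m * Lq ^ k) := by
    intro m k; rw [hω, hω, hLp, hLq, ← hEL]; ring
  have hexp2 : Real.exp (-δ * L) ≤ Real.exp (-(δ / 2) * L) := Real.exp_le_exp.mpr (by nlinarith)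
  have hind : Real.exp (-δ * L) * χL ≤ Real.exp (-(δ / 2) * R) * Real.exp (-(δ / 2) * L) := by
    rw [hχL]; exact exp_mul_indicator_le hδ le_rfl
  have hχsq : χL * χL ≤ χL := by nlinarith
  -- (i) main, (ii) mixed, (iii) indicator
  have hmain : CV * CW * Real.exp (-δ * L) * ((2 * αF * L) * (2 * αG * L))
      ≤ CV * CW * (8 * αF * αG) * (ω 2 (x, w') * ω 0 (y, u) + ω 0 (x, w') * ω 2 (y, u)) := by
    rw [ew, ew, pow_zero, pow_zero, mul_one, one_mul, ← mul_add]
    calc CV * CW * Real.exp (-δ * L) * ((2 * αF * L) * (2 * αG * L)) = CV * CW * (4 * αF * αG) * (Real.exp (-δ * L) * L ^ 2) := by ring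
      _ ≤ CV * CW * (4 * αF * αG) * (Real.exp (-(δ / 2) * L) * (2 * (Lp ^ 2 + Lq ^ 2))) :=
          mul_le_mul_of_nonneg_left (mul_le_mul hexp2 hL2 (by positivity) (by positivity)) (by positivity)
      _ = CV * CW * (8 * αF * αG) * (Real.exp (-(δ / 2) * L) * (Lp ^ 2 + Lq ^ 2)) := by ring
  have hmix : CV * CW * Real.exp (-δ * L) * ((2 * αF * L) * (2 * Gg * χL) + (2 * Fg * χL) * (2 * αG * L))
      ≤ CV * CW * Real.exp (-(δ / 2) * R) * (4 * (αF * Gg + αG * Fg)) * (ω 1 (x, w') * ω 0 (y, u) + ω 0 (x, w') * ω 1 (y, u)) := by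
    rw [ew, ew, pow_zero, pow_one, pow_zero, pow_one, mul_one, one_mul, ← mul_add]
    calc CV * CW * Real.exp (-δ * L) * ((2 * αF * L) * (2 * Gg * χL) + (2 * Fg * χL) * (2 * αG * L))
        = CV * CW * (4 * (αF * Gg + αG * Fg)) * ((Real.exp (-δ * L) * χL) * L) := by ring
      _ ≤ CV * CW * (4 * (αF * Gg + αG * Fg)) * ((Real.exp (-(δ / 2) * R) * Real.exp (-(δ / 2) * L)) * (Lp + Lq)) :=
          mul_le_mul_of_nonneg_left (mul_le_mul hind hLle hL0 (by positivity)) (by positivity)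
      _ = _ := by ring
  have hind' : CV * CW * Real.exp (-δ * L) * ((2 * Fg * χL) * (2 * Gg * χL))
      ≤ CV * CW * Real.exp (-(δ / 2) * R) * (4 * Fg * Gg) * (ω 0 (x, w') * ω 0 (y, u)) := by
    rw [ew, pow_zero, pow_zero, mul_one, mul_one]
    calc CV * CW * Real.exp (-δ * L) * ((2 * Fg * χL) * (2 * Gg * χL)) = CV * CW * (4 * Fg * Gg) * (Real.exp (-δ * L) * (χL * χL)) := by ring
      _ ≤ CV * CW * (4 * Fg * Gg) * (Real.exp (-δ * L) * χL) :=
          mul_le_mul_of_nonneg_left (mul_le_mul_of_nonneg_left hχsq (Real.exp_pos _).le) (by positivity)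
      _ ≤ CV * CW * (4 * Fg * Gg) * (Real.exp (-(δ / 2) * R) * Real.exp (-(δ / 2) * L)) := mul_le_mul_of_nonneg_left hind (by positivity)
      _ = _ := by ring
  -- assemble
  rw [Real.norm_eq_abs, abs_mul, abs_mul, abs_mul]
  have hprod : |bF'| * |bG'| ≤ (2 * αF * L + 2 * Fg * χL) * (2 * αG * L + 2 * Gg * χL) :=
    mul_le_mul hBF' hBG' (abs_nonneg _) (by positivity)
  have hcoef : 0 ≤ (2 * αF * L + 2 * Fg * χL) * (2 * αG * L + 2 * Gg * χL) := by positivity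
  calc |vV| * |vW| * (|bF'| * |bG'|) ≤ (CV * CW * Real.exp (-δ * L)) * ((2 * αF * L + 2 * Fg * χL) * (2 * αG * L + 2 * Gg * χL)) :=
        mul_le_mul hVW hprod (by positivity) (by positivity)
    _ = CV * CW * Real.exp (-δ * L) * ((2 * αF * L) * (2 * αG * L))
        + CV * CW * Real.exp (-δ * L) * ((2 * αF * L) * (2 * Gg * χL) + (2 * Fg * χL) * (2 * αG * L))
        + CV * CW * Real.exp (-δ * L) * ((2 * Fg * χL) * (2 * Gg * χL)) := by ring
    _ ≤ _ := add_le_add (add_le_add hmain hmix) hind'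

/-- [folklore] **THE FAR BOUND OF THE BRACKET DOUBLE SMEAR** (`‖z‖∞ ≥ 8`, `ρ := ⌊‖z‖∞/4⌋`, `R := (‖z‖∞−1)/2`).  Weights `|V(x,w)| ≤ CV·e^{−δ(|x|₁+|w|₁)}`,
`|W(y,u)| ≤ CW·e^{−δ(|y|₁+|u|₁)}`; legs `|F| ≤ Fg`, `|G| ≤ Gg` with OUTER sups `aF, aG` and first differences `≤ bF, bG` on the box; `αF := 4bF + 2aF/ρ`, `αG := 4bG + 2aG/ρ`;
letters `θ_m := 2^{m+1}(m!·e^{δ/4}·(4/δ)^m)·e^{δ/4}·Zl(δ/4)²` (the engine's `Θ_m` at rate `δ/2`):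
`|Σ'_{(x,w),(y,u)} V(x,w)W(y,u)·(F(z+u−x) − F(z+u−w))·(G(z+y−w) − G(z+u−w))| ≤ CV·CW·(16·αF·αG·θ₂·θ₀ + e^{−(δ/2)R}·(8(αF·Gg + αG·Fg)·θ₁·θ₀ + 4·Fg·Gg·θ₀²))`,
and the family is summable. -/
theorem abs_bracket_le_far (hδ : 0 < δ)
    (hV : ∀ p : Pt × Pt, |V p| ≤ CV * (Real.exp (-δ * l1 p.1) * Real.exp (-δ * l1 p.2)))
    (hW : ∀ q : Pt × Pt, |W q| ≤ CW * (Real.exp (-δ * l1 q.1) * Real.exp (-δ * l1 q.2)))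
    (hFg : ∀ t, |F t| ≤ Fg) (hGg : ∀ t, |G t| ≤ Gg) (hz : 8 ≤ supNorm z) (hbF : 0 ≤ bF) (hbG : 0 ≤ bG)
    (hF0 : ∀ t : Pt, supNorm z ≤ 2 * supNorm t → |F t| ≤ aF)
    (hF1 : ∀ t : Pt, (∀ i, |t i - z i| ≤ ((supNorm z / 4 : ℕ) : ℤ)) → ∀ i, |F (t + Pi.single i 1) - F t| ≤ bF)
    (hG0 : ∀ t : Pt, supNorm z ≤ 2 * supNorm t → |G t| ≤ aG)
    (hG1 : ∀ t : Pt, (∀ i, |t i - z i| ≤ ((supNorm z / 4 : ℕ) : ℤ)) → ∀ i, |G (t + Pi.single i 1) - G t| ≤ bG) :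
    (Summable fun P : (Pt × Pt) × (Pt × Pt) =>
        V P.1 * W P.2 * ((F (z + (P.2.2 - P.1.1)) - F (z + (P.2.2 - P.1.2))) * (G (z + (P.2.1 - P.1.2)) - G (z + (P.2.2 - P.1.2)))))
    ∧ |∑' P : (Pt × Pt) × (Pt × Pt),
        V P.1 * W P.2 * ((F (z + (P.2.2 - P.1.1)) - F (z + (P.2.2 - P.1.2))) * (G (z + (P.2.1 - P.1.2)) - G (z + (P.2.2 - P.1.2))))|
      ≤ CV * CW * (16 * (4 * bF + 2 * aF / (((supNorm z / 4 : ℕ) : ℕ) : ℝ)) * (4 * bG + 2 * aG / (((supNorm z / 4 : ℕ) : ℕ) : ℝ))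
              * (2 ^ (2 + 1) * (((2 : ℕ).factorial : ℝ) * Real.exp (δ / 2 / 2) * (2 / (δ / 2)) ^ 2) * Real.exp (δ / 2 / 2) * Zl 4 (δ / 2 / 2) ^ 2)
              * (2 ^ (0 + 1) * (((0 : ℕ).factorial : ℝ) * Real.exp (δ / 2 / 2) * (2 / (δ / 2)) ^ 0) * Real.exp (δ / 2 / 2) * Zl 4 (δ / 2 / 2) ^ 2)
            + Real.exp (-(δ / 2) * (((supNorm z : ℝ) - 1) / 2))
              * (8 * ((4 * bF + 2 * aF / (((supNorm z / 4 : ℕ) : ℕ) : ℝ)) * Gg + (4 * bG + 2 * aG / (((supNorm z / 4 : ℕ) : ℕ) : ℝ)) * Fg)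
                  * (2 ^ (1 + 1) * (((1 : ℕ).factorial : ℝ) * Real.exp (δ / 2 / 2) * (2 / (δ / 2)) ^ 1) * Real.exp (δ / 2 / 2) * Zl 4 (δ / 2 / 2) ^ 2)
                  * (2 ^ (0 + 1) * (((0 : ℕ).factorial : ℝ) * Real.exp (δ / 2 / 2) * (2 / (δ / 2)) ^ 0) * Real.exp (δ / 2 / 2) * Zl 4 (δ / 2 / 2) ^ 2)
                + 4 * Fg * Gg
                  * (2 ^ (0 + 1) * (((0 : ℕ).factorial : ℝ) * Real.exp (δ / 2 / 2) * (2 / (δ / 2)) ^ 0) * Real.exp (δ / 2 / 2) * Zl 4 (δ / 2 / 2) ^ 2) ^ 2)) := by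
  -- constants and their signs
  have hCV : 0 ≤ CV := nonneg_of_loc hV
  have hCW : 0 ≤ CW := nonneg_of_loc hW
  have hFg0 : 0 ≤ Fg := (abs_nonneg _).trans (hFg z)
  have hGg0 : 0 ≤ Gg := (abs_nonneg _).trans (hGg z)
  have haF : 0 ≤ aF := (abs_nonneg _).trans (hF0 z (by omega))
  have haG : 0 ≤ aG := (abs_nonneg _).trans (hG0 z (by omega))
  have hρ' : (0 : ℝ) < (((supNorm z / 4 : ℕ) : ℕ) : ℝ) := by exact_mod_cast (show 0 < supNorm z / 4 by omega)
  -- the two single-leg bracket bounds (before abbreviating, so that the abbreviations rewrite them)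
  have hleg := abs_leg_sub_le_far hFg hz hbF hF0 hF1
  have hleg' := abs_leg_sub_le_far hGg hz hbG hG0 hG1
  set ρ : ℝ := (((supNorm z / 4 : ℕ) : ℕ) : ℝ) with hρ
  set R : ℝ := ((supNorm z : ℝ) - 1) / 2 with hR
  have hαF0 : 0 ≤ 4 * bF + 2 * aF / ρ := by positivity
  have hαG0 : 0 ≤ 4 * bG + 2 * aG / ρ := by positivity
  set αF : ℝ := 4 * bF + 2 * aF / ρ with hαF
  set αG : ℝ := 4 * bG + 2 * aG / ρ with hαG
  clear_value ρ R αF αG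
  have hδ2 : 0 < δ / 2 := half_pos hδ
  -- the one-point-pair letters at rate `δ/2`
  obtain ⟨hs0, hb0⟩ := tsum_prod_expWeight_pow_le (D := 4) hδ2 0
  obtain ⟨hs1, hb1⟩ := tsum_prod_expWeight_pow_le (D := 4) hδ2 1
  obtain ⟨hs2, hb2⟩ := tsum_prod_expWeight_pow_le (D := 4) hδ2 2
  set ω : ℕ → Pt × Pt → ℝ := fun m p => Real.exp (-(δ / 2) * l1 p.1) * Real.exp (-(δ / 2) * l1 p.2) * ((l1 p.1 + 1) + (l1 p.2 + 1)) ^ m with hωdef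
  have hω : ∀ m p, ω m p = Real.exp (-(δ / 2) * l1 p.1) * Real.exp (-(δ / 2) * l1 p.2) * ((l1 p.1 + 1) + (l1 p.2 + 1)) ^ m :=
    fun m p => by rw [hωdef]
  have hωnn : ∀ m, 0 ≤ ω m := fun m p => by have := l1_nonneg p.1; have := l1_nonneg p.2; rw [hω]; positivity
  have hω0 : Summable (ω 0) := hs0
  have hω1 : Summable (ω 1) := hs1
  have hω2 : Summable (ω 2) := hs2
  set T0 : ℝ := ∑' p : Pt × Pt, ω 0 p with hT0
  set T1 : ℝ := ∑' p : Pt × Pt, ω 1 p with hT1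
  set T2 : ℝ := ∑' p : Pt × Pt, ω 2 p with hT2
  have hP : ∀ {f g : Pt × Pt → ℝ} {a b : ℝ}, Summable f → Summable g → 0 ≤ f → 0 ≤ g → ∑' p, f p = a → ∑' p, g p = b →
      HasSum (fun P : (Pt × Pt) × (Pt × Pt) => f P.1 * g P.2) (a * b) := by
    intro f g a b hf hg hf0 hg0 ha hb
    rw [← ha, ← hb]
    exact (hf.hasSum.mul hg.hasSum) (hf.mul_of_nonneg hg hf0 hg0)
  have H20 := hP hω2 hω0 (hωnn 2) (hωnn 0) hT2.symm hT0.symm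
  have H02 := hP hω0 hω2 (hωnn 0) (hωnn 2) hT0.symm hT2.symm
  have H10 := hP hω1 hω0 (hωnn 1) (hωnn 0) hT1.symm hT0.symm
  have H01 := hP hω0 hω1 (hωnn 0) (hωnn 1) hT0.symm hT1.symm
  have H00 := hP hω0 hω0 (hωnn 0) (hωnn 0) hT0.symm hT0.symm
  have hT0le : T0 ≤ _ := hb0
  have hT1le : T1 ≤ _ := hb1
  have hT2le : T2 ≤ _ := hb2
  have hT0nn : 0 ≤ T0 := tsum_nonneg (hωnn 0)
  have hT1nn : 0 ≤ T1 := tsum_nonneg (hωnn 1)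
  have hT2nn : 0 ≤ T2 := tsum_nonneg (hωnn 2)
  clear_value ω T0 T1 T2
  -- the majorant
  set cM : ℝ := CV * CW * (8 * αF * αG) with hcM
  set cI : ℝ := CV * CW * Real.exp (-(δ / 2) * R) * (4 * (αF * Gg + αG * Fg)) with hcI
  set cJ : ℝ := CV * CW * Real.exp (-(δ / 2) * R) * (4 * Fg * Gg) with hcJ
  have hcM0 : 0 ≤ cM := by rw [hcM]; positivity
  have hcI0 : 0 ≤ cI := by rw [hcI]; positivity
  have hcJ0 : 0 ≤ cJ := by rw [hcJ]; positivity
  have HM : HasSum (fun P : (Pt × Pt) × (Pt × Pt) =>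
      cM * (ω 2 P.1 * ω 0 P.2 + ω 0 P.1 * ω 2 P.2) + cI * (ω 1 P.1 * ω 0 P.2 + ω 0 P.1 * ω 1 P.2) + cJ * (ω 0 P.1 * ω 0 P.2))
      (cM * (T2 * T0 + T0 * T2) + cI * (T1 * T0 + T0 * T1) + cJ * (T0 * T0)) :=
    (((H20.add H02).mul_left cM).add ((H10.add H01).mul_left cI)).add (H00.mul_left cJ)
  clear_value cM cI cJ
  -- pointwise domination
  have hdom : ∀ P : (Pt × Pt) × (Pt × Pt),
      ‖V P.1 * W P.2 * ((F (z + (P.2.2 - P.1.1)) - F (z + (P.2.2 - P.1.2))) * (G (z + (P.2.1 - P.1.2)) - G (z + (P.2.2 - P.1.2))))‖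
        ≤ cM * (ω 2 P.1 * ω 0 P.2 + ω 0 P.1 * ω 2 P.2) + cI * (ω 1 P.1 * ω 0 P.2 + ω 0 P.1 * ω 1 P.2) + cJ * (ω 0 P.1 * ω 0 P.2) := by
    rintro ⟨⟨x, w'⟩, ⟨y, u⟩⟩
    have h := pointwise_dom (R := R) hω hδ.le hCV hCW hαF0 hαG0 hFg0 hGg0 (hV (x, w')) (hW (y, u)) (hleg (u - x) (u - w')) (hleg' (y - w') (u - w'))
    rw [hcM, hcI, hcJ]
    exact h
  -- summability and the bound
  have hsum : Summable fun P : (Pt × Pt) × (Pt × Pt) =>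
      V P.1 * W P.2 * ((F (z + (P.2.2 - P.1.1)) - F (z + (P.2.2 - P.1.2))) * (G (z + (P.2.1 - P.1.2)) - G (z + (P.2.2 - P.1.2)))) :=
    Summable.of_norm_bounded HM.summable hdom
  refine ⟨hsum, ?_⟩
  have hb := tsum_of_norm_bounded HM hdom
  rw [Real.norm_eq_abs] at hb
  refine hb.trans ?_
  have e1 : cM * (T2 * T0 + T0 * T2) + cI * (T1 * T0 + T0 * T1) + cJ * (T0 * T0)
      = 2 * cM * (T2 * T0) + 2 * cI * (T1 * T0) + cJ * (T0 * T0) := by ring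
  rw [e1]
  have hθ0 : 0 ≤ (2 : ℝ) ^ (0 + 1) * (((0 : ℕ).factorial : ℝ) * Real.exp (δ / 2 / 2) * (2 / (δ / 2)) ^ 0) * Real.exp (δ / 2 / 2) * Zl 4 (δ / 2 / 2) ^ 2 := by
    have := Zl_pos (D := 4) (half_pos hδ2); positivity
  have a1 := mul_le_mul hT2le hT0le hT0nn (hT2nn.trans hT2le)
  have a2 := mul_le_mul hT1le hT0le hT0nn (hT1nn.trans hT1le)
  have a3 := mul_le_mul hT0le hT0le hT0nn hθ0
  calc 2 * cM * (T2 * T0) + 2 * cI * (T1 * T0) + cJ * (T0 * T0)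
      ≤ 2 * cM * _ + 2 * cI * _ + cJ * _ :=
        add_le_add (add_le_add (mul_le_mul_of_nonneg_left a1 (by positivity)) (mul_le_mul_of_nonneg_left a2 (by positivity)))
          (mul_le_mul_of_nonneg_left a3 hcJ0)
    _ = _ := by rw [hcM, hcI, hcJ, hαF, hαG, hR, pow_two]; ring

end Bubble

end Summit.QuantumFields.BalabanUV.Beta.FP.FarRegionBubble

end
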